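import Literature.MathematicalPhysics.QuantumFieldTheory.Balaban1983to89.B6MultiLevelTorusOperatorL0
import Literature.MathematicalPhysics.QuantumFieldTheory.Balaban1983to89.B6Eq238MultiLevelBoxL0
import Literature.MathematicalPhysics.QuantumFieldTheory.Balaban1983to89.B6Eq238MultiLevelTorus
/-!
# `Balaban1983to89.B6Eq238MultiLevelTorusL0` — LEVEL-0 TWIN (programme G-F3′-L0, director-ym LINE №27 / UV3-NODE §24.5; plan `lit-balaban-r03/G-F3L0-PLAN.md`) of `B6Eq238MultiLevelTorus`:
the same declarations, SAME NAMES AND STATEMENTS, for nested families WITH print's region `Λ₀ = T ∖ Ω₁` ADMITTED (structures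
`B6MultiLevelBoxOperatorL0.Domains` / `B6MultiLevelTorusOperatorL0.TDomains`: levels `0, …, k`, the level-`0` block a single site, `Q′₀ = id`,
finite weight `a₀` — print p.225 (2.14) «Σ_{j=0}^k … (Q′₀λ)(x) = λ(x), x ∈ Λ₀», p.229 «taking a sequence (2.1) … smallest possible domains B^j(Λ_j),
and considering the operator Δ_a defined by (2.19), (2.20) for this sequence»).  Every `D`-free object is the lineage's, consumed BY NAME; no existing
module is touched; no fact is minted.  Unit `lit-balaban-p21` (packet S-B owner, p21 gen 26; port tooling by r03 gen 36); B6 fold owner r03; referee ref-4.  THE TWIN'S DOCUMENTATION FOLLOWS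
VERBATIM (its «levels 1 … k» / «Ω₁ = X» sentences describe the twin; here `j` runs from `0` and `Ω₁` may be a proper subset).

# `Balaban1983to89.B6Eq238MultiLevelTorus` — [B6] (2.36)–(2.38) FOR THE GENUINE `k`-LEVEL OPERATOR `Δ′_a` ON THE
TORUS `T_η`: the multi-size cube cover `𝒟` of the torus, ONE TRANSLATION CHART PER CUBE (every cube term is the
box-lineage term `h_□G′(□)v_□` of a CENTRAL cube of the translated family, transported along the chart), the periodic
(1.118) partition `Σ_□ u_□v_□ = 1`, and `Δ′_aG′₀ = 1 − R` (2.38) on print's carrier — file T2 of the torus carrier of the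
multi-level parametrix (no existing module is touched; no fact is minted)

FRAMING (verbatim cell line):
statement-level skeleton of published theorems with citation tags; proofs where landed; nothing here is a claim about the Yang–Mills mass gap

Source under audit (cell pub-balaban / lit-balaban): T. Bałaban, *Propagators and renormalization transformations for
lattice gauge theories. II*, Commun. Math. Phys. **96** (1984) 223–250 [`Balaban1984PropagatorsII`, "B6"], p. 229 [PDF 7]
(2.36)–(2.39), p. 230 [PDF 8] (2.40)–(2.44) (held text `paper:balaban1984-cmp96-propagators-rt-ii`, p0007/p0008); T. Bałaban,
*Propagators … I*, Commun. Math. Phys. **95** (1984) 17–40 [`Balaban1984PropagatorsI`], (1.118) p. 36 (the partition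
«Σ_{j∈Z} h_j² = 1»).  Unit `lit-balaban-p21` (Phase-2 proof seat p21 gen 15), HOME `run/shared/lean/pub/lit-balaban/`, B6 fold
owner r03, referee ref-4.  Box sibling (consumed BY NAME, untouched): `B6Eq238MultiLevelBox` (p21 gen 10).

## WHAT IS PRINTED (p. 229, verbatim up to notation)

«We cover B^j(Λ_j) by a sum of cubes □ of the size 2ML^jη, each cube being a sum of 2^d big blocks with a center
y ∈ Λ_j … Taking these covers for all j from 0 to k we get a family 𝒟 of cubes □ of different sizes and such that
T_η = ⋃_{□∈𝒟} □. … They satisfy Σ_{□∈𝒟} h_□² = 1. (2.36) … G′₀ = Σ_□ h_□G′(□)h_□, (2.37) where G′(□) is an inverse of Δ′_a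
with some boundary conditions on the boundary of □, e.g. with Neumann boundary conditions as in [3]. Repeating the
calculations in the paper we get Δ′_aG′₀ = I − Σ_□ K(h_□)G′(□)h_□ = I − R, (2.38)».

## WHAT THIS FILE CERTIFIES (kernel-checked; setting of `B6MultiLevelTorusOperator`)

For a nested family `D : TDomains d ℓ M_h k P R` of domains OF THE TORUS `T_η` (fundamental box `Π_μ[0, N₀_μ)`,
`N₀_μ = (M·L^k)·P_μ`, `P_μ ≥ 4`), weights `a_{i+1} = aNext ℓ a_i c_i`, and the torus operator `Δ′_a = mlOpT` of file T1:
* §1 **THE CHART OF A TORUS CUBE**: the level-`j` cubes of the torus are labelled by the periodic centre labels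
  `q ∈ Π_μ[0, P_j,μ)`, `P_j = L^{k−j}P` (centres `M·L^j·q`, sides `2M·L^j`, NO cut cubes — the torus has no boundary); the
  cube `(j, q)` is read in the chart `svec` (the torus translation by `(M·L^k)·(⌊q/L^{k−j}⌋ − 2)`), where it is the box cube
  of the CENTRAL label `qc = q mod L^{k−j} + 2L^{k−j}` (`q_eq_qc_add`; `qc_bounds`: `2 ≤ qc ≤ P_j − 2`, two half-widths
  off every wall).
* §2 `interior_of_uFun_ne_zero`: the printed profile of a central cube vanishes on the wall sites of the fundamental box
  (so the seam of file T1 never meets a cube term).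
* §3 **THE COVER AND THE TRANSPORTED TERMS**: `σc` (chart equivalence), `Dc = (D.chart svec).toDomains` (the box family of
  the chart), `cubeSetT` (active torus cubes; activity read in the chart), `CubeDataT`/`cubeData_chart` (a torus cube IS a
  central box cube of its chart: the lineage's `CubeData`), the cut-offs `uT`/`vT` (`vT_eq`: `v_□ = u_□·1_{B^j(Λ_j)}`), the
  summands **`aT = σ(h_□G′(□)v_□)σ⁻¹`** and **`bT = σ(K(h_□)G′(□)v_□)σ⁻¹`** (reindexed `aX`/`bX` of `B6Eq238MultiLevelBox`
  — the cube propagators are LITERALLY the genuine two-level Neumann cube propagators of the lineage), **`gZeroT = G′₀`**,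
  **`rT = R`**, and **`mlOpT_mul_aT`**: `Δ′_a·(h_□G′(□)v_□) = h_□v_□ − K(h_□)G′(□)v_□` on the torus (the box identity
  `mlOp_mul_aX` of the chart through the chart identity `mlOpT_mul_reindex` of file T1).
* §4 **(2.36) ON THE TORUS**: the transported profile is the printed (1.118) profile of the relabelled lattice label
  `q + P_j·mz(z)` (`uT_eq`; `mz_unique`: a central cube lies inside one period; `Qmap_injOn`, `mem_image_Qmap`), hence
  `Σ_{q∈Π[0,P_j)} u_{(j,q)}(z)² = 1` (`sum_uT_sq`, the PERIODIC partition of unity from the lattice identity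
  `Σ_{q∈ℤ^{d+1}} h_q² = 1` of `B4PartitionUnity22`) and **`Σ_{□∈𝒟} u_□v_□ = 1`** (`sum_uv_eq_one_T`).
* §5 **(2.38) ON THE TORUS**: `eq238_multiLevelTorus` — `Δ′_a·G′₀ = 1 − R`.

## HONEST SCOPE

* As in file T1: levels `1 … k`, `Ω₁ = T_η` (print's admitted case), `A = 0`, `m² = 0`, torus side `(M·L^k)·P_μ` with
  `P_μ ≥ 4` (print's torus is astronomically larger than a cube; four top blocks per direction are what the charts need);
  the partition is the lineage's ASYMMETRIC one (`u_□ = h_□`, `v_□ = h_□·1_{B^j(Λ_j)}`, `Σu_□v_□ = 1` exact; print's symmetric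
  `h_□G′(□)h_□` needs an unprinted matching of the (1.118) families across levels — cell divergence D-b06.38/42); the cube
  propagators are the Neumann two-level inverses of the lineage («e.g. with Neumann boundary conditions»); `R ≥ 2L`.
* Nothing is inferred from the manuscript: every step is kernel-checked; the quoted sentences locate the statements.
-/

namespace Literature.MathematicalPhysics.QuantumFieldTheory.Balaban1983to89.B6Eq238MultiLevelTorusL0

open Finset Matrix
open Literature.MathematicalPhysics.QuantumFieldTheory.Balaban1983to89.B4ContourShift (supNorm abs_le_supNorm
  supNorm_nonneg)
open Literature.MathematicalPhysics.QuantumFieldTheory.Balaban1983to89.B4Reflection242 (boxDom mem_boxDom nbrs mem_nbrs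
  blk)
open Literature.MathematicalPhysics.QuantumFieldTheory.Balaban1983to89.B4TorusKernel.MultiPeriod (torusSupNorm translate
  translate_apply)
open Literature.MathematicalPhysics.QuantumFieldTheory.Balaban1983to89.B6Ineq243TwoLevelBox (aNext)
open Literature.MathematicalPhysics.QuantumFieldTheory.Balaban1983to89.B6Partition236TwoLevelBox (hq hq_add_mul
  abs_lt_of_hq_ne_zero ctrs mem_ctrs mem_ctrs_of_hq_ne_zero pos hq_nonneg)
open Literature.MathematicalPhysics.QuantumFieldTheory.Balaban1983to89.B6Eq238TwoLevelBox (res emb)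
open Literature.MathematicalPhysics.QuantumFieldTheory.Balaban1983to89.B6MultiLevelBoxOperator hiding Domains mlOp_apply
open Literature.MathematicalPhysics.QuantumFieldTheory.Balaban1983to89.B6MultiLevelBoxOperatorL0
open Literature.MathematicalPhysics.QuantumFieldTheory.Balaban1983to89.B6Eq238MultiLevelBox hiding Active CubeData Down Ep LamG aX bX cG cOp cOp_mul_cG ctrs_Pj_subset cubeData_of_mem cubeSet diagonal_mul_eq_pad eq238_multiLevelBox fin fin_data fin_spec gX gZeroML isBlockUnion_LamG lev_corner_ublk mem_LamG mem_cubeSet mlOp_emb_emb mlOp_emb_off mlOp_mul_aX mlOp_mul_term rML row_eq_pad_row sum_uv_eq_one vFun vX window_of_active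
open Literature.MathematicalPhysics.QuantumFieldTheory.Balaban1983to89.B6Eq238MultiLevelBoxL0
open Literature.MathematicalPhysics.QuantumFieldTheory.Balaban1983to89.B6MultiLevelTorusOperator hiding TDomains mlOpT_apply mlOpT_eq_reindex_chart mlOpT_mul_reindex mlOpT_tshift
open Literature.MathematicalPhysics.QuantumFieldTheory.Balaban1983to89.B6MultiLevelTorusOperatorL0
open Literature.MathematicalPhysics.QuantumFieldTheory.Balaban1983to89.B4PartitionUnity22 (hCube sum_hCube_sq)

open Literature.MathematicalPhysics.QuantumFieldTheory.Balaban1983to89.B6Eq238MultiLevelTorus (rj svec qc one_le_rj q_eq_qc_add Pj_eq qc_bounds qc_mem_ctrs bigSide_k_eq N0_eq_mul_Pj interior_of_uFun_ne_zero σc boxDom_Pj_subset uT mz σc_symm_val Qmap uT_eq mz_unique Qmap_injOn mem_image_Qmap sum_uT_sq)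
noncomputable section

variable {d : ℕ}

/-! ## §1 The chart of a torus cube: top-block index, translation vector, central box label -/

section ChartData

variable (ℓ k : ℕ)

variable {ℓ k}

end ChartData

/-! ## §2 The central cube of a chart lies off the walls -/

section InteriorCube

variable {ℓ Mh k : ℕ} {P : Fin (d + 1) → ℕ}

end InteriorCube

/-! ## §3 The cover 𝒟 of the torus, one chart per cube, and the transported cube terms -/

section Cover

variable {ℓ Mh k R : ℕ} {P : Fin (d + 1) → ℕ} (D : TDomains d ℓ Mh k P R) (a c : ℕ → ℝ)

/-- the box family of the chart of the torus cube `(j, q)`. [cite: Balaban1984PropagatorsII, (2.1)–(2.2) p.224, dictionary] -/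
def Dc (j : ℕ) (q : Fin (d + 1) → ℤ) : Domains d ℓ Mh k P R := (D.chart (svec ℓ k j q)).toDomains

/-- the level function of the chart at a chart point is the torus level at the corresponding torus point.
[cite: Balaban1984PropagatorsII, (2.3)–(2.4) p.224, dictionary] -/
theorem Dc_lev_symm (j : ℕ) (q : Fin (d + 1) → ℤ) (z : ↥(boxDom (N0 ℓ Mh k P))) :
    (Dc D j q).lev ((σc ℓ Mh k P j q).symm z).1 = D.lev z.1 := by
  unfold Dc σc
  rw [B6MultiLevelTorusOperatorL0.TDomains.toDomains_lev, B6MultiLevelTorusOperatorL0.TDomains.chart_lev, Equiv.apply_symm_apply]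

open Classical in
/-- **THE COVER 𝒟 OF THE TORUS** as a finite index set: pairs `(j, q)` of a level `0 ≤ j ≤ k` and a periodic centre label
`q ∈ Π_μ[0, P_j,μ)` whose cube is ACTIVE (its profile meets `B^j(Λ_j)`, read in the cube's chart).
[cite: Balaban1984PropagatorsII, p.229 («a family 𝒟 of cubes □ of different sizes and such that T_η = ⋃_{□∈𝒟} □»)] -/
def cubeSetT : Finset (ℕ × (Fin (d + 1) → ℤ)) :=
  ((Finset.Icc 0 k) ×ˢ boxDom (Pj ℓ k P 0)).filter fun cq =>
    cq.2 ∈ boxDom (Pj ℓ k P cq.1) ∧ Active (Dc D cq.1 cq.2) cq.1 (qc ℓ k cq.1 cq.2)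

variable {D}

/-- the periodic label sets shrink with the level: `Π[0, P_j) ⊆ Π[0, P_0)` for every `j`. [cite: Balaban1984PropagatorsII, p.229, dictionary] -/
theorem boxDom_Pj_subset_zero (j : ℕ) : boxDom (Pj ℓ k P j) ⊆ boxDom (Pj ℓ k P 0) := by
  intro q hq
  rw [mem_boxDom] at hq ⊢
  intro μ
  obtain ⟨h0, h1⟩ := hq μ
  refine ⟨h0, lt_of_lt_of_le h1 ?_⟩
  unfold Pj
  exact_mod_cast Nat.mul_le_mul_right _ (Nat.pow_le_pow_right (by omega) (by omega))

/-- membership in the torus cover. [cite: Balaban1984PropagatorsII, p.229] -/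
theorem mem_cubeSetT {cq : ℕ × (Fin (d + 1) → ℤ)} :
    cq ∈ cubeSetT D ↔ (0 ≤ cq.1 ∧ cq.1 ≤ k) ∧ cq.2 ∈ boxDom (Pj ℓ k P cq.1) ∧
      Active (Dc D cq.1 cq.2) cq.1 (qc ℓ k cq.1 cq.2) := by
  classical
  unfold cubeSetT
  rw [Finset.mem_filter, Finset.mem_product, Finset.mem_Icc]
  constructor
  · rintro ⟨⟨hj, -⟩, hq, ha⟩; exact ⟨hj, hq, ha⟩
  · rintro ⟨hj, hq, ha⟩; exact ⟨⟨hj, boxDom_Pj_subset_zero cq.1 hq⟩, hq, ha⟩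

variable (D)

/-- data of an active torus cube: level in `[0, k]` (first conjunct vacuous; positional compatibility with the twin), periodic
label, activity in its chart. [cite: Balaban1984PropagatorsII, p.229–230] -/
structure CubeDataT (cq : ℕ × (Fin (d + 1) → ℤ)) : Prop where
  hj : 0 ≤ cq.1 ∧ cq.1 ≤ k
  hq : cq.2 ∈ boxDom (Pj ℓ k P cq.1)
  hact : Active (Dc D cq.1 cq.2) cq.1 (qc ℓ k cq.1 cq.2)

variable {D}

/-- members of the torus cover carry `CubeDataT`. [cite: Balaban1984PropagatorsII, p.229] -/
theorem cubeDataT_of_mem {cq : ℕ × (Fin (d + 1) → ℤ)} (h : cq ∈ cubeSetT D) : CubeDataT D cq :=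
  let ⟨hj, hq, hact⟩ := mem_cubeSetT.1 h
  ⟨hj, hq, hact⟩

/-- **A TORUS CUBE IS A CENTRAL BOX CUBE OF ITS CHART**: the box-lineage cube data of the label `qc` in the chart family.
[cite: Balaban1984PropagatorsII, p.229–230, dictionary] -/
theorem cubeData_chart (hP4 : ∀ μ, 4 ≤ P μ) {cq : ℕ × (Fin (d + 1) → ℤ)} (hc : CubeDataT D cq) :
    CubeData (Dc D cq.1 cq.2) (cq.1, qc ℓ k cq.1 cq.2) :=
  ⟨hc.hj, qc_mem_ctrs hP4 _ _, hc.hact⟩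

variable (D)

/-- the RIGHT cut-off `v_□ = h_□·1_{B^j(Λ_j)}` of a torus cube, transported from its chart. [cite: Balaban1984PropagatorsII, (2.36)–(2.37) p.229] -/
def vT (cq : ℕ × (Fin (d + 1) → ℤ)) (z : ↥(boxDom (N0 ℓ Mh k P))) : ℝ :=
  vX (Dc D cq.1 cq.2) (cq.1, qc ℓ k cq.1 cq.2) ((σc ℓ Mh k P cq.1 cq.2).symm z)

/-- `v_□ = u_□·1_{lev = j}` on the torus. [cite: Balaban1984PropagatorsII, (2.36)–(2.37) p.229] -/
theorem vT_eq (cq : ℕ × (Fin (d + 1) → ℤ)) (z : ↥(boxDom (N0 ℓ Mh k P))) :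
    vT D cq z = uT cq z * (if D.lev z.1 = cq.1 then 1 else 0) := by
  unfold vT uT vX vFun uX
  rw [Dc_lev_symm]

/-- **THE SUMMAND `h_□G′(□)v_□` OF (2.37) ON THE TORUS**: the box term of the central cube of the chart, transported along
the chart translation. [cite: Balaban1984PropagatorsII, (2.37) p.229] -/
def aT (hP : ∀ μ, 1 ≤ P μ) (hP4 : ∀ μ, 4 ≤ P μ) (cq : ℕ × (Fin (d + 1) → ℤ)) (hc : CubeDataT D cq) :
    Matrix ↥(boxDom (N0 ℓ Mh k P)) ↥(boxDom (N0 ℓ Mh k P)) ℝ :=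
  Matrix.reindex (σc ℓ Mh k P cq.1 cq.2) (σc ℓ Mh k P cq.1 cq.2)
    (aX (Dc D cq.1 cq.2) a c hP (cq.1, qc ℓ k cq.1 cq.2) (cubeData_chart hP4 hc))

/-- **THE SUMMAND `K(h_□)G′(□)v_□` OF `R` (2.38) ON THE TORUS**, transported from the chart. [cite: Balaban1984PropagatorsII, (2.38) p.229, (2.44) p.230] -/
def bT (hP : ∀ μ, 1 ≤ P μ) (hP4 : ∀ μ, 4 ≤ P μ) (cq : ℕ × (Fin (d + 1) → ℤ)) (hc : CubeDataT D cq) :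
    Matrix ↥(boxDom (N0 ℓ Mh k P)) ↥(boxDom (N0 ℓ Mh k P)) ℝ :=
  Matrix.reindex (σc ℓ Mh k P cq.1 cq.2) (σc ℓ Mh k P cq.1 cq.2)
    (bX (Dc D cq.1 cq.2) a c hP (cq.1, qc ℓ k cq.1 cq.2) (cubeData_chart hP4 hc))

/-- **`G′₀ = Σ_{□∈𝒟} h_□G′(□)v_□` (2.37) ON THE TORUS**. [cite: Balaban1984PropagatorsII, (2.37) p.229] -/
def gZeroT (hP : ∀ μ, 1 ≤ P μ) (hP4 : ∀ μ, 4 ≤ P μ) : Matrix ↥(boxDom (N0 ℓ Mh k P)) ↥(boxDom (N0 ℓ Mh k P)) ℝ :=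
  ∑ cq ∈ (cubeSetT D).attach, aT D a c hP hP4 cq.1 (cubeDataT_of_mem cq.2)

/-- **`R = Σ_{□∈𝒟} K(h_□)G′(□)v_□` (2.38) ON THE TORUS**. [cite: Balaban1984PropagatorsII, (2.38) p.229] -/
def rT (hP : ∀ μ, 1 ≤ P μ) (hP4 : ∀ μ, 4 ≤ P μ) : Matrix ↥(boxDom (N0 ℓ Mh k P)) ↥(boxDom (N0 ℓ Mh k P)) ℝ :=
  ∑ cq ∈ (cubeSetT D).attach, bT D a c hP hP4 cq.1 (cubeDataT_of_mem cq.2)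

variable {D a c}

/-- the wall rows of a central box term vanish (its left cut-off does). [cite: Balaban1984PropagatorsII, (2.37) p.229, dictionary] -/
theorem aX_wall_row (hMh : 1 ≤ Mh) (hP : ∀ μ, 1 ≤ P μ) (hP4 : ∀ μ, 4 ≤ P μ) {cq : ℕ × (Fin (d + 1) → ℤ)}
    (hc : CubeDataT D cq) (w : ↥(boxDom (N0 ℓ Mh k P))) (hw : ¬ Interior (N0 ℓ Mh k P) w)
    (y : ↥(boxDom (N0 ℓ Mh k P))) :
    aX (Dc D cq.1 cq.2) a c hP (cq.1, qc ℓ k cq.1 cq.2) (cubeData_chart hP4 hc) w y = 0 := by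
  have hu : uX (ℓ := ℓ) (Mh := Mh) (k := k) (P := P) (cq.1, qc ℓ k cq.1 cq.2) w = 0 := by
    by_contra h
    exact hw (interior_of_uFun_ne_zero hMh hP4 hc.hj.2 cq.2 w h)
  unfold aX
  rw [Matrix.mul_assoc, Matrix.diagonal_mul, hu, zero_mul]

/-- **`Δ′_a` TIMES ONE SUMMAND ON THE TORUS**: `Δ′_a·(h_□G′(□)v_□) = h_□v_□ − K(h_□)G′(□)v_□` — the box identity
`mlOp_mul_aX` of the chart, transported by the chart identity of `B6MultiLevelTorusOperator` (the seam does not see a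
central cube). [cite: Balaban1984PropagatorsII, (2.37)–(2.38) p.229] -/
theorem mlOpT_mul_aT (hℓ : 1 ≤ ℓ) (hR : 2 * (ℓ + 1) ≤ R) (hP : ∀ μ, 1 ≤ P μ) (hP4 : ∀ μ, 4 ≤ P μ) (hMh : 2 ≤ Mh)
    (ha : ∀ i, 0 < a i) (hcpos : ∀ i, 0 < c i)
    (hac : ∀ i, a (i + 1) = aNext ℓ (a i) (c i))
    (cq : ℕ × (Fin (d + 1) → ℤ)) (hc : CubeDataT D cq) :
    mlOpT (N0 ℓ Mh k P) ℓ k D.lev a * aT D a c hP hP4 cq hc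
      = Matrix.diagonal (fun z => uT cq z * vT D cq z) - bT D a c hP hP4 cq hc := by
  have hMh1 : 1 ≤ Mh := le_trans (by norm_num) hMh
  have hMh2 : 2 ≤ Mh := le_trans (by norm_num) hMh
  unfold aT bT σc
  rw [mlOpT_mul_reindex D hMh1 hP a (svec ℓ k cq.1 cq.2) (fun w hw y => aX_wall_row hMh1 hP hP4 hc w hw y)]
  have h := mlOp_mul_aX (D := Dc D cq.1 cq.2) (a := a) (c := c) hℓ hR hP hMh ha hcpos hac
    (cq.1, qc ℓ k cq.1 cq.2) (cubeData_chart hP4 hc)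
  unfold Dc at h ⊢
  rw [h]
  simp only [Matrix.reindex_apply, Matrix.submatrix_sub, Pi.sub_apply, Matrix.submatrix_diagonal_equiv]
  rfl

end Cover

/-! ## §4 (2.36) on the torus: the transported profiles are the PERIODIC (1.118) partition of unity -/

section Partition

variable {ℓ Mh k R : ℕ} {P : Fin (d + 1) → ℕ}

variable {D : TDomains d ℓ Mh k P R}

/-- a cube whose profile sees a site of its own level is active (the site, read in the chart, is the witness).
[cite: Balaban1984PropagatorsII, p.229 («center y ∈ Λ_j (… boundary … also)»)] -/
theorem active_of_uT_ne_zero {j : ℕ} {q : Fin (d + 1) → ℤ} {z : ↥(boxDom (N0 ℓ Mh k P))} (hlev : D.lev z.1 = j)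
    (h : uT (ℓ := ℓ) (Mh := Mh) (k := k) (P := P) (j, q) z ≠ 0) : Active (Dc D j q) j (qc ℓ k j q) :=
  ⟨((σc ℓ Mh k P j q).symm z).1, ((σc ℓ Mh k P j q).symm z).2, by rw [Dc_lev_symm]; exact hlev, h⟩

/-- **(2.36) FOR THE TORUS COVER**: `Σ_{□∈𝒟} u_□(z)v_□(z) = 1` at every site of the torus — the periodic (1.118) identity of
the level of `z`, the other levels cut away by `1_{B^j(Λ_j)}`, inactive cubes vanishing at `z`.
[cite: Balaban1984PropagatorsII, (2.36) p.229; Balaban1984PropagatorsI, (1.118) p.36] -/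
theorem sum_uv_eq_one_T (hMh : 1 ≤ Mh) (hP : ∀ μ, 1 ≤ P μ) (hP4 : ∀ μ, 4 ≤ P μ)
    (z : ↥(boxDom (N0 ℓ Mh k P))) :
    ∑ cq ∈ (cubeSetT D).attach, uT cq.1 z * vT D cq.1 z = 1 := by
  classical
  rw [Finset.sum_attach (cubeSetT D) (fun cq => uT cq z * vT D cq z)]
  unfold cubeSetT
  rw [Finset.sum_filter, Finset.sum_product]
  have hj₀mem : D.lev z.1 ∈ Finset.Icc 0 k := Finset.mem_Icc.2 ⟨Nat.zero_le _, D.lev_le _⟩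
  have hrow : ∀ j ∈ Finset.Icc 0 k, ∑ q ∈ boxDom (Pj ℓ k P 0),
      (if (j, q).2 ∈ boxDom (Pj ℓ k P (j, q).1) ∧ Active (Dc D (j, q).1 (j, q).2) (j, q).1 (qc ℓ k (j, q).1 (j, q).2)
        then uT (j, q) z * vT D (j, q) z else 0)
        = if j = D.lev z.1 then 1 else 0 := by
    intro j hj
    have hjk : j ≤ k := (Finset.mem_Icc.1 hj).2
    -- restrict to the labels of level `j`
    rw [← Finset.sum_subset (boxDom_Pj_subset_zero (k := k) (P := P) j) (fun q _ hq => by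
      dsimp only; rw [if_neg (fun h => hq h.1)])]
    by_cases hjj : j = D.lev z.1
    · rw [if_pos hjj]
      have hterm : ∀ q ∈ boxDom (Pj ℓ k P j),
          (if (j, q).2 ∈ boxDom (Pj ℓ k P (j, q).1) ∧ Active (Dc D (j, q).1 (j, q).2) (j, q).1 (qc ℓ k (j, q).1 (j, q).2)
            then uT (j, q) z * vT D (j, q) z else 0) = uT (ℓ := ℓ) (Mh := Mh) (k := k) (P := P) (j, q) z ^ 2 := by
        intro q hq
        dsimp only
        by_cases hu : uT (ℓ := ℓ) (Mh := Mh) (k := k) (P := P) (j, q) z = 0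
        · rw [hu]; simp
        · rw [if_pos ⟨hq, active_of_uT_ne_zero hjj.symm hu⟩, vT_eq, if_pos hjj.symm]; ring
      rw [Finset.sum_congr rfl hterm]
      exact sum_uT_sq hMh hP hP4 hjk z
    · rw [if_neg hjj]
      refine Finset.sum_eq_zero fun q _ => ?_
      dsimp only
      split_ifs
      · rw [vT_eq, if_neg (fun h => hjj h.symm)]; ring
      · rfl
  rw [Finset.sum_congr rfl hrow]
  simp [hj₀mem]

end Partition

/-! ## §5 (2.38) on the torus -/

section Eq238

variable {ℓ Mh k R : ℕ} {P : Fin (d + 1) → ℕ} {D : TDomains d ℓ Mh k P R} {a c : ℕ → ℝ}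

/-- a finite sum of diagonal matrices is the diagonal matrix of the sum. [folklore] -/
private theorem sum_diagonal {X ι : Type*} [DecidableEq X] (s : Finset ι) (f : ι → X → ℝ) :
    ∑ i ∈ s, Matrix.diagonal (f i) = Matrix.diagonal (fun x => ∑ i ∈ s, f i x) := by
  classical
  induction s using Finset.induction_on with
  | empty => simp
  | insert a s ha ih =>
      rw [Finset.sum_insert ha, ih, Matrix.diagonal_add]
      congr 1
      funext x
      rw [Finset.sum_insert ha]

/-- **[B6] (2.38) FOR THE GENUINE `k`-LEVEL OPERATOR ON THE TORUS `T_η`**: `Δ′_a·G′₀ = 1 − R` with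
`G′₀ = Σ_{□∈𝒟} h_□G′(□)v_□` over the multi-size cover of the torus (every cube term the genuine two-level Neumann cube
propagator of the lineage, transported from the cube's chart) and `R = Σ_{□∈𝒟} K(h_□)G′(□)v_□` — for every nested family
(2.1)–(2.2) of domains of the torus with `R ≥ 2L`, every `k ≥ 1`, `L ≥ 2`, `M_h ≥ 1`, every torus with `P_μ ≥ 4` top blocks
per direction, and every positive weights with `a_{i+1} = aNext ℓ a_i c_i`. [cite: Balaban1984PropagatorsII, (2.36)–(2.38) p.229] -/
theorem eq238_multiLevelTorus (hℓ : 1 ≤ ℓ) (hR : 2 * (ℓ + 1) ≤ R) (hP : ∀ μ, 1 ≤ P μ) (hP4 : ∀ μ, 4 ≤ P μ)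
    (hMh : 2 ≤ Mh) (ha : ∀ i, 0 < a i) (hcpos : ∀ i, 0 < c i)
    (hac : ∀ i, a (i + 1) = aNext ℓ (a i) (c i)) :
    mlOpT (N0 ℓ Mh k P) ℓ k D.lev a * gZeroT D a c hP hP4 = 1 - rT D a c hP hP4 := by
  unfold gZeroT rT
  rw [Finset.mul_sum]
  rw [Finset.sum_congr rfl fun cq _ => mlOpT_mul_aT hℓ hR hP hP4 hMh ha hcpos hac cq.1 (cubeDataT_of_mem cq.2),
    Finset.sum_sub_distrib, sum_diagonal]
  congr 1
  have : (fun x : ↥(boxDom (N0 ℓ Mh k P)) => ∑ cq ∈ (cubeSetT D).attach,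
      uT cq.1 x * vT D cq.1 x) = fun _ => 1 :=
    funext fun z => sum_uv_eq_one_T (D := D) (le_trans (by norm_num) hMh) hP hP4 z
  rw [this]
  exact Matrix.diagonal_one

end Eq238

end

end Literature.MathematicalPhysics.QuantumFieldTheory.Balaban1983to89.B6Eq238MultiLevelTorusL0
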